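import Summits.KontsevichZagierPeriods.KontsevichZagierPeriods.Theorems.SymplecticScissorsTypeAGenerationStubExactDlogAux
import Literature.NumberTheory.Transcendental.AyoubPeriodSeriesLocalizing
import Literature.NumberTheory.Transcendental.AyoubPeriodSeriesTorsion

/-!
# `TypeAGeneration` (stmt-KontsevichZagierPeriods-18392), line `Sketch`: AN EXACT INTEGER DLOG
RELATION IS TYPE (a) (registered stub `stub_exactDlog_of`, lead, cycle 2)

Layer 1 of the line `Sketch` (card stokes-compiler) is Ayoub's Conjecture 1.1 for one-variable
RATIONAL integrands. Its core certificate is proved here: for algebraic `αⱼ` with `‖αⱼ‖ > 1` and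
integers `eⱼ` such that the chosen logarithms satisfy `Σⱼ eⱼ Log(1 − αⱼ⁻¹) = 0` EXACTLY, the
kernel element `Σⱼ eⱼ/(zᵢ − αⱼ)` lies in the `ℚ`-span of the type-(a) elements
`∂G/∂zₙ − G|_{zₙ=1} + G|_{zₙ=0}`, `G ∈ 𝒪_{ℚ-alg}(𝔻̄^∞)`.

Certificate (the `N`-th-root contraction, Ayoub 2015 Rem. 1.5 with the admissibility of the
line's A3 `stub_dlogOfSmallDeviation`): `W = Πⱼ (1 − zᵢ/αⱼ)^{eⱼ/N}` is a product of binomial germs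
(`binGerm[i, αⱼ, eⱼ/N] ∈ 𝒪_{ℚ-alg}`, G1), a LOOP in the `zᵢ`-direction —
`W|_{zᵢ=0} = 1` (G2) and `W|_{zᵢ=1} = Πⱼ (1 − αⱼ⁻¹)^{eⱼ/N} = exp(N⁻¹ Σ eⱼ Log(1 − αⱼ⁻¹)) = 1`
(G3 and the exact relation) —, of deviation `N_ρ(W − 1) ≤ exp(K Σ|eⱼ|/N) − 1 < 1/ρ` for `N ≫ 0`
(`‖C(q,n)‖ ≤ |q|`, G1; deviation of a product, `stub_exactDlogAux`); so A3 puts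
`∂ᵢW · (W̃⁻¹)|_{z_j=1} = W′/W = N⁻¹ Σⱼ eⱼ/(zᵢ − αⱼ)` (logarithmic derivative of a product, G2's
`∂ᵢ (1−zᵢ/α)^a = −(a/α)(1−zᵢ/α)^{a−1}` and exponent law) in the span, and the span is a `ℚ`-space.
The statement is the implication from the germ package G1–G3 (registered stubs
`stub_binGermMemOan`, `stub_binGermCalculus`, `stub_binGermValues`), as registered.
This is crux 18116's typed `ExactDlogRelationInSpan` inside Ayoub's algebra.
-/

noncomputable section

-- `Summit.KontsevichZagierPeriods.KontsevichZagierPeriods.…` is the tree's mandated layout (single-conjunct summit).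
set_option linter.dupNamespace false

namespace Summit.KontsevichZagierPeriods.KontsevichZagierPeriods.TypeAGenerationLine

open Finsupp MvPowerSeries
open Literature.NumberTheory.Transcendental
open Literature.NumberTheory.Transcendental.AyoubRel

/-- The binomial germ `(1 − zᵢ/α)^a ∈ ℂ[[z]]`: Mathlib's `(1 + X)^a` (`PowerSeries.binomialSeries`)
rescaled by `X ↦ −α⁻¹ X` and renamed into the variable `zᵢ` (as `AyoubRel.perGerm`). -/
local notation3 "binGerm[" i ", " α ", " a "]" =>
  (MvPowerSeries.rename (⇑(axisEmb i))
    (PowerSeries.rescale (-(α : ℂ)⁻¹) (PowerSeries.binomialSeries ℂ (a : ℂ)) : MvPowerSeries Unit ℂ) :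
    CSeries)

set_option quotPrecheck false in
/-- The `ℚ`-span of the type-(a) elements of `𝒪_{ℚ-alg}(𝔻̄^∞)`. -/
local notation "𝕊" =>
  kSpan (algebraMap ℚ ℂ) {x : CSeries | ∃ G ∈ Oan (algebraMap ℚ ℂ), ∃ n : ℕ, x = relAC n G}

/-! ## Scalars -/

/-- **Choice of the contraction order `N`**: for `ρ₀ > 0`, reals `K, E` and a floor `B` there is
`N ≥ max(1, B)` with `ρ₀ (exp(K E / N) − 1) < 1`. [folklore] -/
theorem d1_exists_N (ρ₀ K E : ℝ) (hρ₀ : 0 < ρ₀) (B : ℕ) :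
    ∃ N : ℕ, 1 ≤ N ∧ B ≤ N ∧ ρ₀ * (Real.exp (K * E / N) - 1) < 1 := by
  set c : ℝ := Real.log (1 + ρ₀⁻¹) with hc
  have hc0 : 0 < c := Real.log_pos (by have := inv_pos.mpr hρ₀; linarith)
  obtain ⟨N₀, hN₀⟩ := exists_nat_gt (K * E / c)
  refine ⟨max (max B 1) N₀, le_trans (le_max_right B 1) (le_max_left _ _),
    le_trans (le_max_left B 1) (le_max_left _ _), ?_⟩
  set N : ℕ := max (max B 1) N₀ with hN
  have hN1 : (1 : ℝ) ≤ N := by exact_mod_cast le_trans (le_max_right B 1) (le_max_left _ N₀)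
  have hNpos : (0 : ℝ) < N := by linarith
  have hN₀N : (N₀ : ℝ) ≤ N := by exact_mod_cast le_max_right _ _
  have hlt : K * E / N < c := by
    rw [div_lt_iff₀ hNpos]
    rw [div_lt_iff₀ hc0] at hN₀
    nlinarith
  have hexp : Real.exp (K * E / N) < 1 + ρ₀⁻¹ := by
    calc Real.exp (K * E / N) < Real.exp c := Real.exp_lt_exp.mpr hlt
      _ = 1 + ρ₀⁻¹ := by rw [hc, Real.exp_log (by have := inv_pos.mpr hρ₀; linarith)]
  calc ρ₀ * (Real.exp (K * E / N) - 1) < ρ₀ * (1 + ρ₀⁻¹ - 1) := by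
        exact mul_lt_mul_of_pos_left (by linarith) hρ₀
    _ = 1 := by field_simp; ring

/-- `Π (1 + xⱼ) ≤ exp(Σ xⱼ)` for `xⱼ ≥ 0`. [folklore] -/
theorem d1_prod_one_add_le_exp_sum {ι : Type*} (s : Finset ι) (x : ι → ℝ) (hx : ∀ j ∈ s, 0 ≤ x j) :
    ∏ j ∈ s, (1 + x j) ≤ Real.exp (∑ j ∈ s, x j) := by
  rw [Real.exp_sum]
  exact Finset.prod_le_prod (fun j hj => by have := hx j hj; positivity)
    fun j _ => by have := Real.add_one_le_exp (x j); linarith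

/-- **The loop closes**: if `Σⱼ eⱼ Log uⱼ = 0` exactly (`uⱼ ≠ 0`) then
`Πⱼ uⱼ^{eⱼ/N} = exp(N⁻¹ Σⱼ eⱼ Log uⱼ) = 1` for the principal powers. [folklore] -/
theorem d1_prod_cpow_eq_one {m : ℕ} (u : Fin m → ℂ) (e : Fin m → ℤ) (N : ℕ)
    (hu : ∀ j, u j ≠ 0) (h : ∑ j, (e j : ℂ) * Complex.log (u j) = 0) :
    ∏ j, (u j) ^ ((((e j : ℚ) / N : ℚ)) : ℂ) = 1 := by
  have hj : ∀ j, (u j) ^ ((((e j : ℚ) / N : ℚ)) : ℂ) =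
      Complex.exp (Complex.log (u j) * (e j : ℂ) / N) := by
    intro j
    rw [Complex.cpow_def_of_ne_zero (hu j)]
    push_cast
    ring_nf
  simp_rw [hj, ← Complex.exp_sum, ← Finset.sum_div]
  have h' : ∑ j, Complex.log (u j) * (e j : ℂ) = 0 := by
    rw [← h]
    exact Finset.sum_congr rfl fun j _ => mul_comm _ _
  rw [h', zero_div, Complex.exp_zero]

/-! ## The deviation of one factor -/

/-- **Deviation of a one-variable germ with geometric coefficient bound**: if `G` lives on the
`zᵢ`-axis, `G(0) = 1`, and `‖G_{n eᵢ}‖ ≤ c yⁿ` for `n ≥ 1` with `0 ≤ y`, then for the constant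
weight `ρ₀ ≥ 0` with `ρ₀ y ≤ x₀ < 1` one has `N_{ρ₀}(G − 1) ≤ c (1 − x₀)⁻¹`. [folklore] -/
theorem d1_factor_deviation {i : ℕ} {G : CSeries}
    (hoff : ∀ x : ℕ →₀ ℕ, (∀ n : ℕ, x ≠ single i n) → coeff x G = 0)
    (h0 : coeff (0 : ℕ →₀ ℕ) G = 1) {c y ρ₀ x₀ : ℝ} (hc : 0 ≤ c) (hy : 0 ≤ y) (hρ₀ : 0 ≤ ρ₀)
    (hx₀ : ρ₀ * y ≤ x₀) (hx₀1 : x₀ < 1)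
    (hb : ∀ n : ℕ, 1 ≤ n → ‖coeff (single i n) G‖ ≤ c * y ^ n) :
    ∃ D : ℝ, D ≤ c * (1 - x₀)⁻¹ ∧
      HasSum (fun a : ℕ →₀ ℕ => ‖coeff a (G - 1)‖ * a.prod fun _ n => ρ₀ ^ n) D := by
  have hx₀0 : 0 ≤ x₀ := le_trans (mul_nonneg hρ₀ hy) hx₀
  -- the axis family and its geometric majorant
  set f : ℕ → ℝ := fun n => ‖coeff (single i n) (G - 1)‖ * ρ₀ ^ n with hf
  have hf0 : ∀ n, 0 ≤ f n := fun n => mul_nonneg (norm_nonneg _) (pow_nonneg hρ₀ n)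
  have hfle : ∀ n, f n ≤ c * x₀ ^ n := by
    intro n
    rcases Nat.eq_zero_or_pos n with rfl | hn
    · rw [hf]
      simp only [single_zero, map_sub, coeff_zero_one, pow_zero, mul_one]
      rw [h0, sub_self, norm_zero]
      exact hc
    · have hn0 : single i n ≠ 0 := by
        rw [Ne, single_eq_zero]; omega
      rw [hf]
      simp only [map_sub, coeff_one, if_neg hn0, sub_zero]
      calc ‖coeff (single i n) G‖ * ρ₀ ^ n ≤ c * y ^ n * ρ₀ ^ n :=
            mul_le_mul_of_nonneg_right (hb n hn) (pow_nonneg hρ₀ n)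
        _ = c * (ρ₀ * y) ^ n := by rw [mul_pow]; ring
        _ ≤ c * x₀ ^ n :=
            mul_le_mul_of_nonneg_left (pow_le_pow_left₀ (mul_nonneg hρ₀ hy) hx₀ n) hc
  have hgeom : HasSum (fun n : ℕ => c * x₀ ^ n) (c * (1 - x₀)⁻¹) :=
    (hasSum_geometric_of_lt_one hx₀0 hx₀1).mul_left c
  have hfs : Summable f := hgeom.summable.of_nonneg_of_le hf0 hfle
  refine ⟨∑' n, f n, hasSum_le hfle hfs.hasSum hgeom, ?_⟩
  refine d1_hasSum_axis (fun x hx => ?_) ρ₀ hfs.hasSum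
  have hx0 : x ≠ 0 := fun h => hx 0 (by rw [h, single_zero])
  rw [map_sub, coeff_one, if_neg hx0, sub_zero, hoff x hx]

/-! ## The stub -/

/-- **Registered stub `stub_exactDlog_of` — AN EXACT INTEGER DLOG RELATION IS TYPE (a)**, given the
germ package G1–G3: for algebraic `αⱼ` with `‖αⱼ‖ > 1` and integers `eⱼ` with
`Σⱼ eⱼ Log(1 − αⱼ⁻¹) = 0`, `Σⱼ eⱼ/(zᵢ − αⱼ) ∈ ⟨a⟩_ℚ` (`1/(zᵢ − α) = −α⁻¹ (1 − zᵢ/α)⁻¹`).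
Certificate: the `N`-th-root contraction `W = Πⱼ (1 − zᵢ/αⱼ)^{eⱼ/N}`, a small-deviation loop for
`N ≫ 0`, fed to A3 `stub_dlogOfSmallDeviation`; `W′/W = N⁻¹ Σⱼ eⱼ/(zᵢ − αⱼ)`.
[cite: Ayoub2015, Rem. 1.5] -/
theorem stub_exactDlog_of :
    (∀ (i : ℕ) (α : ℂ), IsAlgebraic ℚ α → 1 < ‖α‖ → ∀ (q : ℚ),
      binGerm[i, α, (q : ℂ)] ∈ Oan (algebraMap ℚ ℂ) ∧
      (∀ l : ℕ, UsesVar (binGerm[i, α, (q : ℂ)]) l → l = i) ∧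
      (∀ ρ : ℕ → ℝ, (∀ l, 0 ≤ ρ l) → ρ i < ‖α‖ →
        Summable fun a : ℕ →₀ ℕ =>
          ‖MvPowerSeries.coeff a (binGerm[i, α, (q : ℂ)])‖ * a.prod fun l n => ρ l ^ n) ∧
      (|q| ≤ 1 → ∀ n : ℕ, 1 ≤ n → ‖Ring.choose (q : ℂ) n‖ ≤ |(q : ℝ)|)) →
    (∀ (i : ℕ) (α : ℂ),
      (∀ (a : ℂ) (n : ℕ), MvPowerSeries.coeff (Finsupp.single i n) (binGerm[i, α, a]) =
        Ring.choose a n * (-α⁻¹) ^ n) ∧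
      (∀ (a : ℂ) (x : ℕ →₀ ℕ), (∀ n : ℕ, x ≠ Finsupp.single i n) →
        MvPowerSeries.coeff x (binGerm[i, α, a]) = 0) ∧
      (∀ a b : ℂ, binGerm[i, α, a + b] = binGerm[i, α, a] * binGerm[i, α, b]) ∧
      binGerm[i, α, (0 : ℂ)] = 1 ∧
      binGerm[i, α, (1 : ℂ)] = 1 - C α⁻¹ * X i ∧
      (∀ a : ℂ, pdz i (binGerm[i, α, a]) = (-(a * α⁻¹)) • binGerm[i, α, a - 1]) ∧
      (∀ a : ℂ, restrC i 0 (binGerm[i, α, a]) = 1)) →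
    (∀ (i : ℕ) (α : ℂ), 1 < ‖α‖ →
      (∀ a : ℂ, restrC i 1 (binGerm[i, α, a]) = C ((1 - α⁻¹) ^ a)) ∧
      intC ((-α⁻¹) • binGerm[i, α, (-1 : ℂ)]) = Complex.log (1 - α⁻¹)) →
    ∀ (i m : ℕ) (α : Fin m → ℂ) (e : Fin m → ℤ), (∀ j, IsAlgebraic ℚ (α j) ∧ 1 < ‖α j‖) →
      ∑ j, (e j : ℂ) * Complex.log (1 - (α j)⁻¹) = 0 →
      ∑ j, (e j : ℂ) • ((-(α j)⁻¹) • binGerm[i, α j, (-1 : ℂ)]) ∈ 𝕊 := by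
  intro hG1 hG2 hG3 i m α e hα hlog
  -- degenerate case `m = 0`
  rcases isEmpty_or_nonempty (Fin m) with hm | hm
  · rw [Fintype.sum_empty]
    exact s6_zero_mem_kSpan (algebraMap ℚ ℂ) _
  /- (1) SCALARS: the smallest modulus `a₀ > 1`, the common weight `1 < ρ₀ < a₀`, the ratio
  `x₀ = ρ₀/a₀ < 1`, `K = (1 − x₀)⁻¹`, `E = Σ|eⱼ|`, the floor `B = max |eⱼ|`, and the order `N`. -/
  obtain ⟨j₀, -, hj₀⟩ := Finset.exists_min_image Finset.univ (fun j => ‖α j‖) Finset.univ_nonempty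
  set a₀ : ℝ := ‖α j₀‖ with ha₀def
  have ha₀ : 1 < a₀ := (hα j₀).2
  have ha₀j : ∀ j, a₀ ≤ ‖α j‖ := fun j => hj₀ j (Finset.mem_univ j)
  set ρ₀ : ℝ := (1 + a₀) / 2 with hρ₀def
  have hρ₀1 : 1 < ρ₀ := by rw [hρ₀def]; linarith
  have hρ₀0 : 0 < ρ₀ := by linarith
  have hρ₀a : ρ₀ < a₀ := by rw [hρ₀def]; linarith
  set x₀ : ℝ := ρ₀ / a₀ with hx₀def
  have hx₀1 : x₀ < 1 := by rwa [hx₀def, div_lt_one (by linarith)]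
  have hx₀0 : 0 < x₀ := by positivity
  set K : ℝ := (1 - x₀)⁻¹ with hKdef
  have hK0 : 0 < K := by rw [hKdef]; exact inv_pos.mpr (by linarith)
  set E : ℝ := ∑ j, |(e j : ℝ)| with hEdef
  set B : ℕ := Finset.univ.sup fun j => (e j).natAbs with hBdef
  obtain ⟨N, hN1, hNB, hNsmall⟩ := d1_exists_N ρ₀ K E hρ₀0 B
  have hN0 : (N : ℂ) ≠ 0 := by exact_mod_cast (show N ≠ 0 by omega)
  have hNR : (0 : ℝ) < N := by exact_mod_cast (show 0 < N by omega)
  -- exponents `qⱼ = eⱼ/N`, `|qⱼ| ≤ 1`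
  set q : Fin m → ℚ := fun j => (e j : ℚ) / N with hqdef
  have hqR : ∀ j, ((q j : ℚ) : ℝ) = (e j : ℝ) / N := fun j => by rw [hqdef]; push_cast; rfl
  have hqabs : ∀ j, |((q j : ℚ) : ℝ)| = |(e j : ℝ)| / N := fun j => by
    rw [hqR, abs_div, Nat.abs_cast]
  have hq1 : ∀ j, |q j| ≤ 1 := by
    intro j
    have h1 : ((e j).natAbs : ℝ) ≤ N := by
      exact_mod_cast le_trans (Finset.le_sup (f := fun j => (e j).natAbs) (Finset.mem_univ j)) hNB
    have h2 : |(e j : ℝ)| ≤ N := by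
      rw [← Int.cast_abs, Int.abs_eq_natAbs]
      exact_mod_cast h1
    have h3 : |((q j : ℚ) : ℝ)| ≤ 1 := by
      rw [hqabs, div_le_one hNR]
      exact h2
    exact_mod_cast h3
  /- (2) THE FACTORS `gⱼ = (1 − zᵢ/αⱼ)^{qⱼ}`, THE LOOP `W = Π gⱼ`, THE POLE GERMS `pⱼ`. -/
  set g : Fin m → CSeries := fun j => binGerm[i, α j, ((q j : ℚ) : ℂ)] with hgdef
  set W : CSeries := ∏ j, g j with hWdef
  set p : Fin m → CSeries := fun j => (-(α j)⁻¹) • binGerm[i, α j, (-1 : ℂ)] with hpdef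
  have hgOan : ∀ j, g j ∈ Oan (algebraMap ℚ ℂ) := fun j => (hG1 i (α j) (hα j).1 (hα j).2 (q j)).1
  have hgvar : ∀ j l, UsesVar (g j) l → l = i := fun j => (hG1 i (α j) (hα j).1 (hα j).2 (q j)).2.1
  have hWOan : W ∈ Oan (algebraMap ℚ ℂ) := d1_prod_mem_Oan _ _ _ fun j _ => hgOan j
  have hWvar : ∀ l, UsesVar W l → l = i := by
    intro l hl
    obtain ⟨j, -, hj⟩ := d1_usesVar_prod Finset.univ g hl
    exact hgvar j l hj
  -- the auxiliary variable
  have hij : i ≠ i + 1 := by omega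
  have hWj : ¬ UsesVar W (i + 1) := fun h => absurd (hWvar _ h) (by omega)
  -- (3) THE FACE `zᵢ = 0`: `W|₀ = 1`
  have hW0 : restrC i 0 W = 1 := by
    rw [hWdef, d1_restrC_zero_prod]
    exact Finset.prod_eq_one fun j _ => (hG2 i (α j)).2.2.2.2.2.2 _
  -- (4) THE FACE `zᵢ = 1`: `W|₁ = Π (1 − αⱼ⁻¹)^{qⱼ} = 1` (the exact relation)
  have hu : ∀ j, (1 : ℂ) - (α j)⁻¹ ≠ 0 := by
    intro j h
    have h1 : ‖(α j)⁻¹‖ < 1 := by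
      rw [norm_inv]; exact inv_lt_one_of_one_lt₀ (hα j).2
    rw [sub_eq_zero] at h
    rw [← h, norm_one] at h1
    exact lt_irrefl _ h1
  have hW1 : restrC i 1 W = 1 := by
    rw [hWdef, d1_restrC_one_prod (algebraMap ℚ ℂ) i Finset.univ g fun j _ => hgOan j]
    have hfac : ∀ j, restrC i 1 (g j) = C ((1 - (α j)⁻¹) ^ (((q j : ℚ)) : ℂ)) :=
      fun j => (hG3 i (α j) (hα j).2).1 _
    simp_rw [hfac]
    rw [← map_prod (C : ℂ →+* CSeries), d1_prod_cpow_eq_one _ e N hu hlog, map_one]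
  /- (5) THE DEVIATION: `N_{ρ₀}(gⱼ − 1) ≤ |qⱼ| K`, hence `N_{ρ₀}(W − 1) ≤ Π (1 + |qⱼ| K) − 1
  ≤ exp(K E / N) − 1 < 1/ρ₀`. -/
  have hdev : ∀ j, ∃ D : ℝ, D ≤ |((q j : ℚ) : ℝ)| * K ∧
      HasSum (fun a : ℕ →₀ ℕ => ‖coeff a (g j - 1)‖ * a.prod fun _ n => ρ₀ ^ n) D := by
    intro j
    have hG2j := hG2 i (α j)
    refine d1_factor_deviation (fun x hx => hG2j.2.1 _ x hx) ?_ (abs_nonneg _)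
      (inv_nonneg.mpr (norm_nonneg (α j))) hρ₀0.le ?_ hx₀1 fun n hn => ?_
    · have h := hG2j.1 (((q j : ℚ)) : ℂ) 0
      rw [single_zero] at h
      rw [h, Ring.choose_zero_right, pow_zero, mul_one]
    · -- `ρ₀ ‖αⱼ‖⁻¹ ≤ ρ₀ / a₀ = x₀`
      rw [hx₀def, div_eq_mul_inv]
      exact mul_le_mul_of_nonneg_left ((inv_le_inv₀ (by linarith [ha₀j j]) (by linarith)).mpr
        (ha₀j j)) hρ₀0.le
    · rw [hG2j.1, norm_mul, norm_pow, norm_neg, norm_inv]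
      exact mul_le_mul_of_nonneg_right
        ((hG1 i (α j) (hα j).1 (hα j).2 (q j)).2.2.2 (hq1 j) n hn) (pow_nonneg (by positivity) n)
  obtain ⟨S, hSle, hS⟩ := stub_exactDlogAux (fun _ => ρ₀) (fun _ => hρ₀0.le) m g
    (fun j => |((q j : ℚ) : ℝ)| * K) hdev
  have hSbound : ρ₀ * S < 1 := by
    have h1 : ∏ j, (1 + |((q j : ℚ) : ℝ)| * K) ≤ Real.exp (K * E / N) := by
      refine (d1_prod_one_add_le_exp_sum Finset.univ _ fun j _ => by positivity).trans ?_
      apply Real.exp_le_exp.mpr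
      have he : ∑ j, |((q j : ℚ) : ℝ)| * K = K * E / N := by
        rw [hEdef, Finset.mul_sum, Finset.sum_div]
        refine Finset.sum_congr rfl fun j _ => ?_
        rw [hqabs]
        ring
      exact he.le
    have h0S : 0 ≤ S := hS.nonneg fun b => mul_nonneg (norm_nonneg _) (s3_wprod_nonneg (fun _ => hρ₀0.le) b)
    nlinarith
  -- in the shape consumed by A3 / U1b (`U = 1`)
  have hS' : HasSum (fun a : ℕ →₀ ℕ =>
      ‖coeff a ((W - restrC i 0 W) * 1)‖ * a.prod fun l n => (fun _ : ℕ => ρ₀) l ^ n) S := by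
    rw [hW0, mul_one]; exact hS
  have hWU : restrC i 0 W * 1 = 1 := by rw [hW0, mul_one]
  have h1Oan : (1 : CSeries) ∈ Oan (algebraMap ℚ ℂ) := one_mem_Oan _
  have h1s : Summable fun a : ℕ →₀ ℕ => ‖coeff a (1 : CSeries)‖ * a.prod fun l n => (fun _ : ℕ => ρ₀) l ^ n :=
    (d1_hasSum_norm_one _).summable
  /- (6) A3: `∂ᵢW · (W̃⁻¹)|_{z_{i+1}=1} ∈ 𝕊`, and U1b: `W̃ = 1 + z_{i+1}(W − 1)` is a unit of
  `𝒪_{ℚ-alg}(𝔻̄^∞)`. -/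
  have hA3 := stub_dlogOfSmallDeviation ℚ (algebraMap ℚ ℂ) i (i + 1) hij W 1 hWOan h1Oan hWj
    (hW1.trans hW0.symm) hWU (fun _ => ρ₀) (fun _ => hρ₀1) h1s S hS' hSbound
  obtain ⟨hVOan, hWV, -⟩ := stub_unitOfSmallDeviation_of stub_weightedNormMul
    (stub_geometricMajorant_of stub_weightedNormMul) ℚ (algebraMap ℚ ℂ) i (i + 1) hij W 1 hWOan
    h1Oan hWU (fun _ => ρ₀) (fun _ => hρ₀1) h1s S hS' hSbound
  set Wt : CSeries := restrC i 0 W + X (i + 1) * (W - restrC i 0 W) with hWtdef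
  -- (7) `(W̃⁻¹)|_{z_{i+1}=1}` is a right inverse of `W`
  have hWtOan : Wt ∈ Oan (algebraMap ℚ ℂ) := by
    rw [hWtdef, hW0]
    exact add_mem_Oan _ h1Oan (mul_mem_Oan _ (s2_X_mem_Oan _ _) (sub_mem_Oan _ hWOan h1Oan))
  have hWt1 : restrC (i + 1) 1 Wt = W := by
    have hW1j : ¬ UsesVar (W - 1) (i + 1) := by
      intro h
      rcases usesVar_sub h with h' | h'
      · exact hWj h'
      · exact not_usesVar_one _ h'
    rw [hWtdef, hW0, s4_restrC_add (i + 1) (summable_norm_coeff_of_mem_Oan (algebraMap ℚ ℂ) h1Oan)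
      (summable_norm_coeff_of_mem_Oan (algebraMap ℚ ℂ)
        (mul_mem_Oan _ (s2_X_mem_Oan _ _) (sub_mem_Oan _ hWOan h1Oan))),
      s4_restrC_one, s2_restrC_one_X_mul, d1_restrC_one_of_not_usesVar hW1j, add_sub_cancel]
  have hinv : W * restrC (i + 1) 1 Wt⁻¹ = 1 := by
    have h := congrArg (restrC (i + 1) 1) hWV
    rwa [s4_restrC_mul (summable_norm_coeff_of_mem_Oan (algebraMap ℚ ℂ) hWtOan)
      (summable_norm_coeff_of_mem_Oan (algebraMap ℚ ℂ) hVOan), s4_restrC_one, hWt1] at h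
  /- (8) THE LOGARITHMIC DERIVATIVE: `∂ᵢ gⱼ = gⱼ · (qⱼ pⱼ)`, so `∂ᵢ W = W · Σ qⱼ pⱼ` and the A3
  element is `Σ qⱼ pⱼ`. -/
  have hdlog : ∀ j, pdz i (g j) = g j * ((((q j : ℚ)) : ℂ) • p j) := by
    intro j
    have hG2j := hG2 i (α j)
    have h1 := hG2j.2.2.2.2.2.1 (((q j : ℚ)) : ℂ)
    rw [sub_eq_add_neg, hG2j.2.2.1] at h1
    rw [hgdef, hpdef, h1, smul_smul, mul_smul_comm]
    congr 1
    ring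
  have hpdzW : pdz i W = W * ∑ j, (((q j : ℚ)) : ℂ) • p j :=
    d1_pdz_prod_of_dlog i Finset.univ g _ fun j _ => hdlog j
  have hH : ∑ j, (((q j : ℚ)) : ℂ) • p j ∈
      kSpan (algebraMap ℚ ℂ) {x : CSeries | ∃ G ∈ Oan (algebraMap ℚ ℂ), ∃ n : ℕ, x = relAC n G} := by
    have h : pdz i W * restrC (i + 1) 1 Wt⁻¹ = ∑ j, (((q j : ℚ)) : ℂ) • p j := by
      rw [hpdzW, mul_right_comm, hinv, one_mul]
    rw [← h]
    exact hA3
  -- (9) multiply by `N`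
  have heq : ∑ j, (e j : ℂ) • p j = ((N : ℚ) : ℂ) • ∑ j, (((q j : ℚ)) : ℂ) • p j := by
    rw [Finset.smul_sum]
    refine Finset.sum_congr rfl fun j _ => ?_
    symm
    rw [smul_smul]
    congr 1
    simp only [hqdef]
    push_cast
    field_simp
  rw [heq]
  exact s6_ratCast_smul_mem_kSpan (algebraMap ℚ ℂ) (N : ℚ) hH

end Summit.KontsevichZagierPeriods.KontsevichZagierPeriods.TypeAGenerationLine
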